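import Summits.BirchSwinnertonDyer.BirchSwinnertonDyer.Theorems.PrintCf2SplitBadEisensteinTwoDivisibilitiesHalfDescentClass
import HarnessLib

/-!
# Crux `PrintCf2.SplitBadTwoRankOneOfFacts` (item 20368), line `eisenstein_two_bdp_line` v9.3 — the two halves of `BSD₂` on the class from
# FRAME-FREE, Λ-FREE finite-level `K`-side halves: «`ord₂ #Ш(E/K) ≤ ord₂ #Ш_an(E/K)`» resp. «`≥`» at a Heegner field with `L(E^{d_K},1) ≠ 0`

Cell `bsd-print-cf2`, seat `bsd-line-cf2-p1-w4` g2 (EXTRA WIDTH seat on crux stmt-BirchSwinnertonDyer-20368; lead `bsd-line-cf2-p1` g7, FINAL).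
`--supports stmt-BirchSwinnertonDyer-20368` (helper). Theses-free; THEOREMS ONLY (0 definitions, 0 named facts, 0 `sorry`); CONDITIONAL on
every displayed hypothesis. BSD is proved for no curve by any of this; no summit statement is proved by this seat.

WHY (memo `Cruxes/SplitBadTwoRankOneOfFacts/U-DIAGNOSTIC-w4g2.md`, option (ii)). In v9.3 the Kolyvagin half of the crux's `BSD₂` clause is
derived from the Λ-adic research stub `stub_upperDivisibility_two` THROUGH the print-gap stub `stub_existsIntegralBDP_two` (a `2`-adic ♭-BDP
frame must EXIST), the LZZ fact, the control socket (F1, F2′) and D2b — but all that the descent consumes is the `T = 0` content, the `K`-side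
inequality `hKup` of lead g7's `missingUpperBoundAt_of_upperOver_of_bsdp_twist` (p631598). This file wires the two `K`-side halves DIRECTLY to
the two halves over `ℚ`, so that a lead may register the finite-level texts below as stubs and make EACH half of `BSD₂` independent of the
frame's existence, of `R1.IsBDPLFunctionInt`, of `ι′`, of Λ-torsion and of the local CM display (robust against a refutation of Stub 1):

  `stub_kolyvaginUpperOverKAtTwo` (proposed text; research content = Kolyvagin's `2`-adic bound over `K` for CM curves with rational
  `2`-torsion, Gross–Zagier included in the currency `shaAnOver`):
    ∀ (W : WeierstrassCurve ℚ) [W.IsElliptic] [W.IsGloballyMinimal], W.HasCM → W.analyticRank = 1 → CMSplit W 2 → ¬ Good W 2 →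
      ∀ (N : ℕ) [NeZero N] (K : Type) [Field K] [NumberField K] (W' : WeierstrassCurve K) [W'.IsElliptic] [W'.IsGloballyMinimal],
        W.conductorNorm ℤ = N → IsImaginaryQuadratic K → SatisfiesHeegnerHypothesis N K →
        (W.quadraticTwist (NumberField.discr K : ℚ)).entireLFunction 1 ≠ 0 → (∃ C : VariableChange K, C • W.baseChange K = W') →
        ∃ q' : ℚ, shaAnOver W' = (q' : ℂ) ∧ (padicValNat 2 W'.shaOrder : ℤ) ≤ padicValRat 2 q'
  `stub_eisensteinLowerOverKAtTwo`: the same with conclusion `∃ q' : ℚ, shaAnOver W' = (q' : ℂ) ∧ padicValRat 2 q' ≤ (padicValNat 2 W'.shaOrder : ℤ)`.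

Integration (one line each, replacing v9.3's `kolyvaginHalf_of_stubs` / `eisensteinHalf_of_stubs` bodies):
  `missingUpperBoundAt_two_of_upperOverK_of_twist hPr.1 (milne_two stub_prints_two) W hr (stub_kolyvaginUpperOverKAtTwo W hCM hr hsplit hng)
     (PrintCf2.rankZeroTwistBSDp_two_of_hasCM_of_print hBF hmod W hCM)` (and the lower twin).
Of `ToricPublishedInputs` only GZK, modularity, Friedberg–Hoffstein (a Heegner field with `3` split and `L(E^{d_K},1) ≠ 0`) and parity are used.

* `missingUpperBoundAt_two_of_upperOverK_of_twist` — ONE `W` with `r_an(W) = 1` (no CM, no conductor hypothesis): `K`-side upper half at every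
  Heegner field with non-vanishing twisted value + twin `BSD₂` ⟹ `MissingUpperBoundAt W 2`.
* `missingLowerBoundAt_two_of_lowerOverK_of_twist` — the Eisenstein twin.

References: [Kolyvagin1990] Thm. A (shape); [GrossZagier1986] V.(2.2); [Milne1972ArithmeticAV] §1 Thm. 1; [FriedbergHoffstein1995] Thm. B;
[Miller2011LMS] Def. 1.1.
-/

set_option autoImplicit false

-- D-0017 layout: summit = sub-problem, so `Summit.BirchSwinnertonDyer.BirchSwinnertonDyer.…` is the mandated namespace of Theorems files.
set_option linter.dupNamespace false

noncomputable section

open scoped Classical MatrixGroups ModularForm Topology NumberField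

namespace Summit.BirchSwinnertonDyer.BirchSwinnertonDyer.Theorems.PrintCf2.EisensteinTwo

open Filter CongruenceSubgroup WeierstrassCurve NumberField IsDedekindDomain Field PowerSeries
  Literature.NumberTheory.EllipticCurves Literature.NumberTheory.EllipticCurves.ModularForms
  Literature.NumberTheory.EllipticCurves.LiuZhangZhang2018 Literature.NumberTheory.EllipticCurves.Rank1Residual
  Literature.NumberTheory.EllipticCurves.Rank1Residual.Typed Literature.NumberTheory.EllipticCurves.KrizLi2019
  Literature.NumberTheory.GaloisRepresentations Literature.NumberTheory.GaloisCohomology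
  Summit.BirchSwinnertonDyer.Rank1Residual Summit.BirchSwinnertonDyer.Rank1Residual.X11b
  Summit.BirchSwinnertonDyer.Rank1Residual.X11b.AcSelmer Summit.BirchSwinnertonDyer.Rank1Residual.X11b.CongruenceLimit
  Summit.BirchSwinnertonDyer.Rank1Residual.X11b.Halves Summit.BirchSwinnertonDyer.Rank1Residual.X2
  Summit.BirchSwinnertonDyer.Rank1Residual.Additive Summit.BirchSwinnertonDyer.Rank1Residual.AdditivePotMult
  Summit.BirchSwinnertonDyer.BirchSwinnertonDyer.Theses.UniversalToricDescent
  Summit.BirchSwinnertonDyer.BirchSwinnertonDyer.Theorems.UniversalToricDescentWaldspurgerFlat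

/-! ### §1 The Kolyvagin half from the frame-free `K`-side upper half -/

/-- **THE EULER-SYSTEM HALF OF `BSD₂(W)` FROM THE FINITE-LEVEL `K`-SIDE UPPER HALF ALONE.** For ONE globally minimal `W/ℚ` with
`r_an(W) = 1`, GIVEN the toric published inputs `hF` (GZK, modularity, Friedberg–Hoffstein Thm. B, parity are used), Milne 1972 on minimal
models `hMilne`, the `K`-side UPPER half `hKup` — at every Heegner field `K` of `N_W` with `L(E^{d_K}, 1) ≠ 0` and every globally minimal
`K`-model `W'` of `E_K`: `#Ш_an(W')` is a rational `q'` with `ord₂ #Ш(W') ≤ ord₂ q'` — and the twin's `BSD₂` `hTw`, THEN `MissingUpperBoundAt W 2`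
(`ord₂ #Ш(W) ≤ ord₂ #Ш_an(W)`). No frame, no `Λ`, no `ι′`, no CM: Friedberg–Hoffstein supplies the field, `E_K` keeps the minimal model
(`isGloballyMinimal_baseChange_of_satisfiesHeegnerHypothesis`), then lead g7's one-sided Milne descent `missingUpperBoundAt_of_upperOver_of_bsdp_twist`.
[cite: Kolyvagin1990, Thm. A (shape)] [cite: Milne1972ArithmeticAV, §1 Thm. 1] [cite: FriedbergHoffstein1995, Thm. B] [cite: Miller2011LMS, Def. 1.1] -/
theorem missingUpperBoundAt_two_of_upperOverK_of_twist
    (hF : ToricPublishedInputs) (hMilne : Milne1972.bsdQuotient_baseChange_quadratic)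
    (W : WeierstrassCurve ℚ) [W.IsElliptic] [W.IsGloballyMinimal] (hr : W.analyticRank = 1)
    (hKup : ∀ (N : ℕ) [NeZero N] (K : Type) [Field K] [NumberField K]
      (W' : WeierstrassCurve K) [W'.IsElliptic] [W'.IsGloballyMinimal],
      W.conductorNorm ℤ = N → IsImaginaryQuadratic K → SatisfiesHeegnerHypothesis N K →
      (W.quadraticTwist (NumberField.discr K : ℚ)).entireLFunction 1 ≠ 0 →
      (∃ C : VariableChange K, C • W.baseChange K = W') →
      ∃ q' : ℚ, shaAnOver W' = (q' : ℂ) ∧ (padicValNat 2 W'.shaOrder : ℤ) ≤ padicValRat 2 q')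
    (hTw : ∀ (N : ℕ) [NeZero N] (K : Type) [Field K] [NumberField K]
      (Wd : WeierstrassCurve ℚ) [Wd.IsElliptic] [Wd.IsGloballyMinimal],
      W.conductorNorm ℤ = N → IsImaginaryQuadratic K → SatisfiesHeegnerHypothesis N K →
      (∃ C : VariableChange ℚ, C • W.quadraticTwist (NumberField.discr K : ℚ) = Wd) →
      (W.quadraticTwist (NumberField.discr K : ℚ)).entireLFunction 1 ≠ 0 → BSDp Wd 2) :
    MissingUpperBoundAt W 2 := by
  obtain ⟨-, -, hGZK, hmod, -, -, -, hFH, hpar, -⟩ := hF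
  haveI hN0 : NeZero (W.conductorNorm ℤ) := ⟨W.conductorNorm_pos_holds.ne'⟩
  -- parity and the Friedberg–Hoffstein field
  have hw : W.rootNumber = -1 := by
    rcases W.rootNumber_eq_one_or with h | h
    · exfalso
      have heven : Even W.analyticRank := (hpar W).mpr h
      rw [hr] at heven
      exact Nat.not_even_one heven
    · exact h
  obtain ⟨K, _, _, hK, -, hHN, -, hLt⟩ := hFH W hw 6 (by norm_num) 0
  have h2 : Module.finrank ℚ K = 2 := hK.1
  haveI : (W.baseChange K).IsGloballyMinimal := W.isGloballyMinimal_baseChange_of_satisfiesHeegnerHypothesis K h2 hHN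
  -- the twin and its rank
  have hD0 : (NumberField.discr K : ℚ) ≠ 0 := by exact_mod_cast NumberField.discr_ne_zero K
  haveI hEt : (W.quadraticTwist (NumberField.discr K : ℚ)).IsElliptic := W.isElliptic_quadraticTwist hD0
  have hrd0 : (W.quadraticTwist (NumberField.discr K : ℚ)).analyticRank = 0 :=
    ((W.quadraticTwist (NumberField.discr K : ℚ)).analyticRank_eq_zero_iff_holds (hmod _)).mpr hLt
  obtain ⟨Cd, hCd⟩ := hasGlobalMinimalModel_rat_holds (W.quadraticTwist (NumberField.discr K : ℚ))
  haveI : (Cd • W.quadraticTwist (NumberField.discr K : ℚ)).IsGloballyMinimal := hCd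
  have hWd : BSDp (Cd • W.quadraticTwist (NumberField.discr K : ℚ)) 2 :=
    hTw (W.conductorNorm ℤ) K (Cd • W.quadraticTwist (NumberField.discr K : ℚ)) rfl hK hHN ⟨Cd, rfl⟩ hLt
  have hrW : W.analyticRank ≤ 1 := by rw [hr]
  have hrd : (Cd • W.quadraticTwist (NumberField.discr K : ℚ)).analyticRank ≤ 1 := by
    rw [analyticRank_smul, hrd0]; exact zero_le_one
  -- the `K`-side half on the minimal model `E_K` and the one-sided descent
  have hKup₁ := hKup (W.conductorNorm ℤ) K (W.baseChange K) rfl hK hHN hLt ⟨1, one_smul _ _⟩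
  exact missingUpperBoundAt_of_upperOver_of_bsdp_twist W 2 K (Cd • W.quadraticTwist (NumberField.discr K : ℚ)) (W.baseChange K)
    hGZK hmod hMilne hrW h2 ⟨Cd, rfl⟩ hrd ⟨1, one_smul _ _⟩ hKup₁ hWd

/-! ### §2 The Eisenstein half from the frame-free `K`-side lower half -/

/-- **THE EISENSTEIN HALF OF `BSD₂(W)` FROM THE FINITE-LEVEL `K`-SIDE LOWER HALF ALONE.** Same data with `hKlo` the `K`-side LOWER half
(`ord₂ #Ш_an(W') ≤ ord₂ #Ш(W')`, `#Ш_an(W')` rational) at every Heegner field with `L(E^{d_K},1) ≠ 0`: THEN `MissingLowerBoundAt W 2`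
(`ord₂ #Ш_an(W) ≤ ord₂ #Ш(W)`), by `missingLowerBoundAt_of_lowerOver_of_bsdp_twist`.
[cite: Milne1972ArithmeticAV, §1 Thm. 1] [cite: FriedbergHoffstein1995, Thm. B] [cite: Miller2011LMS, Def. 1.1] -/
theorem missingLowerBoundAt_two_of_lowerOverK_of_twist
    (hF : ToricPublishedInputs) (hMilne : Milne1972.bsdQuotient_baseChange_quadratic)
    (W : WeierstrassCurve ℚ) [W.IsElliptic] [W.IsGloballyMinimal] (hr : W.analyticRank = 1)
    (hKlo : ∀ (N : ℕ) [NeZero N] (K : Type) [Field K] [NumberField K]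
      (W' : WeierstrassCurve K) [W'.IsElliptic] [W'.IsGloballyMinimal],
      W.conductorNorm ℤ = N → IsImaginaryQuadratic K → SatisfiesHeegnerHypothesis N K →
      (W.quadraticTwist (NumberField.discr K : ℚ)).entireLFunction 1 ≠ 0 →
      (∃ C : VariableChange K, C • W.baseChange K = W') →
      ∃ q' : ℚ, shaAnOver W' = (q' : ℂ) ∧ padicValRat 2 q' ≤ (padicValNat 2 W'.shaOrder : ℤ))
    (hTw : ∀ (N : ℕ) [NeZero N] (K : Type) [Field K] [NumberField K]
      (Wd : WeierstrassCurve ℚ) [Wd.IsElliptic] [Wd.IsGloballyMinimal],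
      W.conductorNorm ℤ = N → IsImaginaryQuadratic K → SatisfiesHeegnerHypothesis N K →
      (∃ C : VariableChange ℚ, C • W.quadraticTwist (NumberField.discr K : ℚ) = Wd) →
      (W.quadraticTwist (NumberField.discr K : ℚ)).entireLFunction 1 ≠ 0 → BSDp Wd 2) :
    MissingLowerBoundAt W 2 := by
  obtain ⟨-, -, hGZK, hmod, -, -, -, hFH, hpar, -⟩ := hF
  haveI hN0 : NeZero (W.conductorNorm ℤ) := ⟨W.conductorNorm_pos_holds.ne'⟩
  have hw : W.rootNumber = -1 := by
    rcases W.rootNumber_eq_one_or with h | h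
    · exfalso
      have heven : Even W.analyticRank := (hpar W).mpr h
      rw [hr] at heven
      exact Nat.not_even_one heven
    · exact h
  obtain ⟨K, _, _, hK, -, hHN, -, hLt⟩ := hFH W hw 6 (by norm_num) 0
  have h2 : Module.finrank ℚ K = 2 := hK.1
  haveI : (W.baseChange K).IsGloballyMinimal := W.isGloballyMinimal_baseChange_of_satisfiesHeegnerHypothesis K h2 hHN
  have hD0 : (NumberField.discr K : ℚ) ≠ 0 := by exact_mod_cast NumberField.discr_ne_zero K
  haveI hEt : (W.quadraticTwist (NumberField.discr K : ℚ)).IsElliptic := W.isElliptic_quadraticTwist hD0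
  have hrd0 : (W.quadraticTwist (NumberField.discr K : ℚ)).analyticRank = 0 :=
    ((W.quadraticTwist (NumberField.discr K : ℚ)).analyticRank_eq_zero_iff_holds (hmod _)).mpr hLt
  obtain ⟨Cd, hCd⟩ := hasGlobalMinimalModel_rat_holds (W.quadraticTwist (NumberField.discr K : ℚ))
  haveI : (Cd • W.quadraticTwist (NumberField.discr K : ℚ)).IsGloballyMinimal := hCd
  have hWd : BSDp (Cd • W.quadraticTwist (NumberField.discr K : ℚ)) 2 :=
    hTw (W.conductorNorm ℤ) K (Cd • W.quadraticTwist (NumberField.discr K : ℚ)) rfl hK hHN ⟨Cd, rfl⟩ hLt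
  have hrW : W.analyticRank ≤ 1 := by rw [hr]
  have hrd : (Cd • W.quadraticTwist (NumberField.discr K : ℚ)).analyticRank ≤ 1 := by
    rw [analyticRank_smul, hrd0]; exact zero_le_one
  have hKlo₁ := hKlo (W.conductorNorm ℤ) K (W.baseChange K) rfl hK hHN hLt ⟨1, one_smul _ _⟩
  exact missingLowerBoundAt_of_lowerOver_of_bsdp_twist W 2 K (Cd • W.quadraticTwist (NumberField.discr K : ℚ)) (W.baseChange K)
    hGZK hmod hMilne hrW h2 ⟨Cd, rfl⟩ hrd ⟨1, one_smul _ _⟩ hKlo₁ hWd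

end Summit.BirchSwinnertonDyer.BirchSwinnertonDyer.Theorems.PrintCf2.EisensteinTwo

end
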